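import Summits.CriticalPhenomena.Ising3DConformalLimit.Theorems.ExistsScaleCovariantLimit.Negative.DyadicIdentity
import Summits.CriticalPhenomena.Ising3DConformalLimit.Theorems.MoebiusLimitExists.Negative.ClusterPointTranslation
import Mathlib.Topology.UniformSpace.UniformApproximation
import Mathlib.Data.Set.Countable
import HarnessLib

/-!
# Continuity of a sequential scaling limit of the critical `ℤ³` correlators is AUTOMATIC
(crux `ExistsScaleCovariantLimit`, item stmt-CriticalPhenomena-1981; line `Sketch`
= `two-hierarchies-force-the-filter`, stub `stub_dyadicLimitContinuous`)

The registered stub asks: every locally uniform limit `S n` of the pinned zoom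
`rescaledCorrelator (criticalCorr 3) rhoPin n (2^{-k})` along the DYADIC meshes is continuous on
`NonCoincident 3 n`. We prove the stronger structural fact, for ANY renormalisation `ρ` and ANY mesh
sequence `u k → 0⁺` (no equicontinuity, no two-point input, no subsequence bookkeeping):

* `continuousWithinAt_limit_of_generic` (any lattice family `G` on `ℤ^d`): a locally uniform
  limit on `NonCoincident d n` is continuous (within `NonCoincident`) at every GENERIC configuration
  — one with no coordinate on any of the grids `u k · ℤ`: the `k`-th zoom is constant on the
  `u k`-cell of `x`, which is then a NEIGHBOURHOOD of `x` (`cell_mem_nhds`), so the `ε/2` estimate at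
  ONE good index `K` already gives `|S y − S x| < ε` near `x`.
* `limit_translate_of_continuousWithinAt` (critical `ℤ³` correlators): at such a continuity point
  the limit is invariant under EVERY simultaneous translation `v ∈ ℝ³` — the zoom at `x + v` equals
  the zoom at `x + w_k`, `‖w_k‖ ≤ 2 u_k`, up to a lattice translation (`latticeApprox_add_eq`,
  `criticalCorr_translate`; the argument of `clusterPoint_translate_of_continuousOn`, localised).
* `exists_translate_generic`: every configuration has a generic translate (each coordinate excludes
  countably many shifts), hence `seqLimit_translate`: the limit is translation invariant on
  `NonCoincident`, and `continuousOn_seqLimit`: it is continuous on `NonCoincident` (transport the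
  continuity at the generic translate back by the translation).

Corollaries: `continuousOn_of_isClusterPoint` (every cluster point of the pinned zoom is continuous
off the diagonals — the `hcont` hypothesis of `isRegular_of_clusterPoint` is redundant) and the stub
`stub_dyadicLimitContinuous` (meshes `2^{-k}`). The "digit-function" obstruction for general lattice
families is exactly the failure of lattice translation invariance; for `criticalCorr 3` nothing beyond
`criticalCorr_translate` is used. [folklore]
-/

noncomputable section
namespace Summit.CriticalPhenomena.Ising3DConformalLimit.Cruxes.ExistsScaleCovariantLimit.TwoHierarchies
open Literature.Probability.LatticeModels Filter Set
open scoped Topology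
open Summit.CriticalPhenomena.Ising3DConformalLimit.MoebiusLimitExistsOnlyInteraction (rhoPin)

/-! ### Generic configurations are continuity points (any lattice family, any dimension, any meshes) -/

variable {d : ℕ}

/-- If no coordinate of the configuration `x` lies on the grid `δ·ℤ` (`δ ≠ 0`), the `δ`-cell of `x`
(all coordinates in the same `δ`-cells as those of `x`) is a neighbourhood of `x`. [folklore] -/
theorem cell_mem_nhds {n : ℕ} {δ : ℝ} (hδ : δ ≠ 0) {x : Fin n → EuclideanSpace ℝ (Fin d)}
    (hgen : ∀ (i : Fin n) (j : Fin d) (m : ℤ), x i j ≠ m * δ) :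
    {y : Fin n → EuclideanSpace ℝ (Fin d) | ∀ i j, ⌊x i j / δ⌋ = ⌊y i j / δ⌋} ∈ 𝓝 x := by
  have h : ∀ i j, ∀ᶠ y in 𝓝 x, ⌊x i j / δ⌋ = ⌊y i j / δ⌋ := by
    intro i j
    have ha : (⌊x i j / δ⌋ : ℝ) ≠ x i j / δ := by
      intro h
      exact hgen i j ⌊x i j / δ⌋ (by rw [h, div_mul_cancel₀ _ hδ])
    have hlt : (⌊x i j / δ⌋ : ℝ) < x i j / δ := lt_of_le_of_ne (Int.floor_le _) ha
    have hcont : Continuous fun y : Fin n → EuclideanSpace ℝ (Fin d) => y i j / δ := by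
      fun_prop
    have hmem : Set.Ioo (⌊x i j / δ⌋ : ℝ) (⌊x i j / δ⌋ + 1) ∈ 𝓝 (x i j / δ) :=
      Ioo_mem_nhds hlt (Int.lt_floor_add_one _)
    filter_upwards [hcont.continuousAt.preimage_mem_nhds hmem] with y hy
    exact (Int.floor_eq_iff.2 ⟨le_of_lt hy.1, hy.2⟩).symm
  exact eventually_all.2 fun i => eventually_all.2 fun j => h i j

/-- **A sequential locally uniform limit of rescaled lattice correlators is continuous (within
`NonCoincident`) at every generic configuration** — any lattice family on `ℤ^d`, any renormalisation,
any meshes `u k` (eventually positive): if no coordinate of `x` lies on any grid `u k · ℤ`, the `k`-th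
zoom is constant on a neighbourhood of `x` for every `k`, and the uniform `ε/2`-estimate near `x` at a
single good index transfers to the limit. [folklore] -/
theorem continuousWithinAt_limit_of_generic {G : LatticeCorrFamily d} {ρ : ℝ → ℝ} {u : ℕ → ℝ}
    {n : ℕ} {T : (Fin n → EuclideanSpace ℝ (Fin d)) → ℝ}
    (hconv : TendstoLocallyUniformlyOn (fun k => rescaledCorrelator G ρ n (u k)) T atTop
      (NonCoincident d n))
    (hu : ∀ᶠ k in atTop, 0 < u k) {x : Fin n → EuclideanSpace ℝ (Fin d)}
    (hx : x ∈ NonCoincident d n) (hgen : ∀ (k : ℕ) (i : Fin n) (j : Fin d) (m : ℤ), x i j ≠ m * u k) :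
    ContinuousWithinAt T (NonCoincident d n) x := by
  rw [Metric.continuousWithinAt_iff']
  intro ε hε
  obtain ⟨t, ht, hev⟩ := Metric.tendstoLocallyUniformlyOn_iff.1 hconv (ε / 2) (half_pos hε) x hx
  obtain ⟨K, hK, hKpos⟩ := (hev.and hu).exists
  have hxt : x ∈ t := mem_of_mem_nhdsWithin hx ht
  have hcell := cell_mem_nhds (n := n) hKpos.ne' (hgen K)
  filter_upwards [ht, mem_nhdsWithin_of_mem_nhds hcell] with y hyt hy
  have hy' : ∀ i j, ⌊x i j / u K⌋ = ⌊y i j / u K⌋ := hy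
  have e1 : dist (T y) (rescaledCorrelator G ρ n (u K) y) < ε / 2 := hK y hyt
  have e2 : dist (T x) (rescaledCorrelator G ρ n (u K) x) < ε / 2 := hK x hxt
  have heq : rescaledCorrelator G ρ n (u K) x = rescaledCorrelator G ρ n (u K) y :=
    LimitMeshContinuity.rescaledCorrelator_eq_of_floor_eq G ρ n (u K) hy'
  calc dist (T y) (T x)
      ≤ dist (T y) (rescaledCorrelator G ρ n (u K) y) + dist (rescaledCorrelator G ρ n (u K) y) (T x) :=
        dist_triangle _ _ _
    _ < ε / 2 + ε / 2 := by
        refine add_lt_add e1 ?_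
        rw [← heq, dist_comm]
        exact e2
    _ = ε := by ring

/-! ### The critical `ℤ³` correlators: translations at a continuity point -/

/-- **At a continuity point, a sequential limit of the critical `ℤ³` correlators is invariant under
every simultaneous translation** (any renormalisation, any mesh sequence `u k → 0⁺`): the zoom at
`x + v` equals the zoom at `x + w_k` with `w_k = v − u_k·[v/u_k]`, `‖w_k‖ ≤ 2u_k → 0`, by lattice
translation invariance; the latter tends to `T x` by continuity of `T` within `NonCoincident` at `x`.
[cite: FriedliVelenik2017, Thm. 3.17] -/
theorem limit_translate_of_continuousWithinAt {ρ : ℝ → ℝ} {u : ℕ → ℝ}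
    (hu : Tendsto u atTop (𝓝[>] (0 : ℝ))) {n : ℕ} {T : (Fin n → EuclideanSpace ℝ (Fin 3)) → ℝ}
    (hconv : TendstoLocallyUniformlyOn (fun k => rescaledCorrelator (criticalCorr 3) ρ n (u k)) T atTop
      (NonCoincident 3 n))
    {x : Fin n → EuclideanSpace ℝ (Fin 3)} (hx : x ∈ NonCoincident 3 n)
    (hcont : ContinuousWithinAt T (NonCoincident 3 n) x) (v : EuclideanSpace ℝ (Fin 3)) :
    T (fun i => x i + v) = T x := by
  -- adapted from `MoebiusLimitExistsNegative.clusterPoint_translate_of_continuousOn` (continuity at `x` only)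
  set w : ℕ → EuclideanSpace ℝ (Fin 3) := fun k => v - u k • siteVec (latticeApprox (u k) v) with hw
  have hupos : ∀ᶠ k in atTop, 0 < u k := hu.eventually self_mem_nhdsWithin
  -- exact identity of the two zooms
  have hzoom : ∀ᶠ k in atTop, rescaledCorrelator (criticalCorr 3) ρ n (u k) (fun i => x i + w k) =
      rescaledCorrelator (criticalCorr 3) ρ n (u k) (fun i => x i + v) := by
    filter_upwards [hupos] with k hk
    rw [rescaledCorrelator_apply, rescaledCorrelator_apply]
    congr 1
    have h : (fun i => latticeApprox (u k) (x i + v)) =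
        fun i => latticeApprox (u k) (x i + w k) + latticeApprox (u k) v := by
      funext i
      exact MoebiusLimitExistsNegative.latticeApprox_add_eq hk (x i) v
    rw [h, MoebiusLimitExistsNegative.criticalCorr_translate]
  -- `w_k → 0`
  have hw0 : Tendsto w atTop (𝓝 0) := by
    refine squeeze_zero_norm' ?_ ?_ (a := fun k => 2 * u k)
    · filter_upwards [hupos] with k hk using
        MoebiusLimitExistsNegative.norm_sub_smul_siteVec_latticeApprox_le hk v
    · simpa using (tendsto_nhds_of_tendsto_nhdsWithin hu).const_mul 2
  have h1 : Tendsto (fun k => rescaledCorrelator (criticalCorr 3) ρ n (u k) (fun i => x i + v)) atTop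
      (𝓝 (T (fun i => x i + v))) :=
    hconv.tendsto_at ((MoebiusLimitExistsNegative.add_mem_nonCoincident_iff v x).2 hx)
  have hg : Tendsto (fun k => fun i => x i + w k) atTop (𝓝[NonCoincident 3 n] x) := by
    refine tendsto_nhdsWithin_iff.2 ⟨?_, Eventually.of_forall fun k =>
      (MoebiusLimitExistsNegative.add_mem_nonCoincident_iff (w k) x).2 hx⟩
    have : Tendsto (fun k => fun i => x i + w k) atTop (𝓝 (fun i => x i + 0)) :=
      tendsto_pi_nhds.2 fun i => tendsto_const_nhds.add hw0
    simpa using this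
  have h2 : Tendsto (fun k => rescaledCorrelator (criticalCorr 3) ρ n (u k) (fun i => x i + w k)) atTop
      (𝓝 (T x)) := hconv.tendsto_comp hcont hx hg
  exact tendsto_nhds_unique (h2.congr' hzoom) h1 |>.symm

/-! ### Generic translates exist -/

/-- Every configuration has a simultaneous translate none of whose coordinates lies on any of the
countably many grids `u k · ℤ` (each coordinate excludes only countably many shifts). [folklore] -/
theorem exists_translate_generic {n : ℕ} (u : ℕ → ℝ) (x : Fin n → EuclideanSpace ℝ (Fin 3)) :
    ∃ v : EuclideanSpace ℝ (Fin 3),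
      ∀ (k : ℕ) (i : Fin n) (j : Fin 3) (m : ℤ), (x i + v) j ≠ m * u k := by
  have hcoord : ∀ j : Fin 3, ∃ t : ℝ, ∀ (k : ℕ) (i : Fin n) (m : ℤ), x i j + t ≠ m * u k := by
    intro j
    set B : Set ℝ := Set.range (fun p : ℕ × Fin n × ℤ => (p.2.2 : ℝ) * u p.1 - x p.2.1 j) with hB
    have hBc : B.Countable := Set.countable_range _
    obtain ⟨t, ht⟩ : ∃ t, t ∉ B := by
      by_contra h
      push Not at h
      exact Set.not_countable_univ (hBc.mono fun t _ => h t)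
    refine ⟨t, fun k i m h => ht ⟨(k, i, m), ?_⟩⟩
    show (m : ℝ) * u k - x i j = t
    linarith
  choose t ht using hcoord
  refine ⟨WithLp.toLp 2 t, fun k i j m => ?_⟩
  rw [PiLp.add_apply, PiLp.toLp_apply]
  exact ht j k i m

/-! ### Main theorems: translation invariance and continuity of every sequential limit -/

/-- **Every sequential locally uniform limit of the critical `ℤ³` correlators is translation invariant
on `NonCoincident`** (any renormalisation, any mesh sequence `u k → 0⁺`; no continuity assumed):
move to a generic translate `z = x + w` (a continuity point, `continuousWithinAt_limit_of_generic`)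
and translate from there (`limit_translate_of_continuousWithinAt`). [folklore] -/
theorem seqLimit_translate {ρ : ℝ → ℝ} {u : ℕ → ℝ} (hu : Tendsto u atTop (𝓝[>] (0 : ℝ))) {n : ℕ}
    {T : (Fin n → EuclideanSpace ℝ (Fin 3)) → ℝ}
    (hconv : TendstoLocallyUniformlyOn (fun k => rescaledCorrelator (criticalCorr 3) ρ n (u k)) T atTop
      (NonCoincident 3 n))
    (v : EuclideanSpace ℝ (Fin 3)) {x : Fin n → EuclideanSpace ℝ (Fin 3)} (hx : x ∈ NonCoincident 3 n) :
    T (fun i => x i + v) = T x := by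
  obtain ⟨w, hw⟩ := exists_translate_generic u x
  have hupos : ∀ᶠ k in atTop, 0 < u k := hu.eventually self_mem_nhdsWithin
  have hz : (fun i => x i + w) ∈ NonCoincident 3 n :=
    (MoebiusLimitExistsNegative.add_mem_nonCoincident_iff w x).2 hx
  have hzc : ContinuousWithinAt T (NonCoincident 3 n) (fun i => x i + w) :=
    continuousWithinAt_limit_of_generic hconv hupos hz hw
  have h1 : T x = T (fun i => x i + w) := by
    have h := limit_translate_of_continuousWithinAt hu hconv hz hzc (-w)
    have e : (fun i => (x i + w) + (-w)) = x := funext fun i => by simp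
    rw [e] at h
    exact h
  have h2 : T (fun i => x i + v) = T (fun i => x i + w) := by
    have h := limit_translate_of_continuousWithinAt hu hconv hz hzc (v - w)
    have e : (fun i => (x i + w) + (v - w)) = fun i => x i + v := funext fun i => by abel
    rw [e] at h
    exact h
  rw [h2, h1]

/-- **Every sequential locally uniform limit of the critical `ℤ³` correlators is continuous off the
diagonals** (any renormalisation `ρ`, any mesh sequence `u k → 0⁺`, every `n`): continuity at a
generic translate `x + w` (`continuousWithinAt_limit_of_generic`), transported to `x` by the full
translation invariance of the limit (`seqLimit_translate`). [folklore] -/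
theorem continuousOn_seqLimit {ρ : ℝ → ℝ} {u : ℕ → ℝ} (hu : Tendsto u atTop (𝓝[>] (0 : ℝ))) {n : ℕ}
    {T : (Fin n → EuclideanSpace ℝ (Fin 3)) → ℝ}
    (hconv : TendstoLocallyUniformlyOn (fun k => rescaledCorrelator (criticalCorr 3) ρ n (u k)) T atTop
      (NonCoincident 3 n)) :
    ContinuousOn T (NonCoincident 3 n) := by
  intro x hx
  obtain ⟨w, hw⟩ := exists_translate_generic u x
  have hupos : ∀ᶠ k in atTop, 0 < u k := hu.eventually self_mem_nhdsWithin
  have hz : (fun i => x i + w) ∈ NonCoincident 3 n :=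
    (MoebiusLimitExistsNegative.add_mem_nonCoincident_iff w x).2 hx
  have hzc : ContinuousWithinAt T (NonCoincident 3 n) (fun i => x i + w) :=
    continuousWithinAt_limit_of_generic hconv hupos hz hw
  have hmap : ContinuousWithinAt
      (fun y : Fin n → EuclideanSpace ℝ (Fin 3) => fun i => y i + w) (NonCoincident 3 n) x :=
    (by fun_prop : Continuous fun y : Fin n → EuclideanSpace ℝ (Fin 3) => fun i => y i + w).continuousWithinAt
  have hmaps : MapsTo (fun y : Fin n → EuclideanSpace ℝ (Fin 3) => fun i => y i + w)
      (NonCoincident 3 n) (NonCoincident 3 n) :=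
    fun y hy => (MoebiusLimitExistsNegative.add_mem_nonCoincident_iff w y).2 hy
  have hcomp : ContinuousWithinAt (T ∘ fun y : Fin n → EuclideanSpace ℝ (Fin 3) => fun i => y i + w)
      (NonCoincident 3 n) x := hzc.comp hmap hmaps
  refine hcomp.congr (fun y hy => ?_) ?_
  · exact (seqLimit_translate hu hconv w hy).symm
  · exact (seqLimit_translate hu hconv w hx).symm

/-- **Every cluster point of the pinned zoom is continuous off the diagonals** — the continuity
hypothesis of `isRegular_of_clusterPoint` / of the compactness schema's output is automatic.
[folklore] -/
theorem continuousOn_of_isClusterPoint {S : CorrFamily 3}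
    (hS : MoebiusLimitExistsOnlyInteraction.IsClusterPoint S) (n : ℕ) :
    ContinuousOn (S n) (NonCoincident 3 n) := by
  obtain ⟨u, hu, hconv⟩ := hS
  exact continuousOn_seqLimit hu (hconv n)

/-- **Stub `stub_dyadicLimitContinuous` of line `Sketch`** (crux `ExistsScaleCovariantLimit`, item
stmt-CriticalPhenomena-1981): every locally uniform limit of the pinned zoom along the dyadic meshes
`2^{-k}` is continuous on `NonCoincident 3 n`, for every `n` — unconditionally, by
`continuousOn_seqLimit` at `u k = (2^k)⁻¹`. [folklore] -/
theorem stub_dyadicLimitContinuous : ∀ S : CorrFamily 3, (∀ n : ℕ, TendstoLocallyUniformlyOn (fun k : ℕ => rescaledCorrelator (criticalCorr 3) rhoPin n (((2:ℝ) ^ k)⁻¹)) (S n) atTop (NonCoincident 3 n)) → ∀ n : ℕ, ContinuousOn (S n) (NonCoincident 3 n) := by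
  intro S hS n
  exact continuousOn_seqLimit ExistsScaleCovariantLimitNegative.Dyadic.tendsto_dyad (hS n)

end Summit.CriticalPhenomena.Ising3DConformalLimit.Cruxes.ExistsScaleCovariantLimit.TwoHierarchies

end
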